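import Summits.Langlands.Langlands.Theorems.PhantomRMYoshidaResiduallyYoshidaLiftingCrossRegularDefs
import Summits.Langlands.Langlands.Theorems.PhantomRMYoshidaResiduallyYoshidaLiftingCrossRegularSupply
import Summits.Langlands.Langlands.Theorems.PhantomRMYoshidaResiduallyYoshidaLiftingLimitAtFixedLevel
import Summits.Langlands.Langlands.Theorems.PhantomRMYoshidaResiduallyYoshidaLiftingTraceCatalogueOfFrob
import Summits.Langlands.Langlands.Theorems.PhantomRMYoshidaResiduallyYoshidaLiftingTraceCatalogueOfFiniteCuspidal
import Summits.Langlands.Langlands.Theorems.PhantomRMYoshidaResiduallyYoshidaLiftingCrossLevelRaisingSeedParts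
import Summits.Langlands.Langlands.Theorems.ResiduallyYoshidaLifting.Negative.ExactCrossElementFrobTwistThree
import HarnessLib

/-!
# `ResiduallyYoshidaLifting` (stmt-Langlands-13639, route PhantomRMYoshida) — line `cross-primes-anchored`
# STRATEGIST SKELETON (planner-cstrat-stmt-Langlands-13639-s1-0, 2026-08-17, rev 1) — an ALTERNATIVE line; the live
# skeleton `Lines/sector_klingen_split.lean` (lead c3-0) is untouched.

Crux (fixed, by name): `Summit.Langlands.Langlands.Theses.PhantomRMYoshida.ResiduallyYoshidaLifting` — RELATIVE automorphy
lifting at a residually-Yoshida point in weight (2,2) (`Aut ρ₀ → Aut ρ` on an admissible fibre).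

Line = the Khare–Thorne cross-prime scheme of the dead line C `cross-regular-annihilator-primes` (lead -2, skeleton rev 3,
dead file `Lines/cross-regular-annihilator-primes-dead.md`) REVIVED BY A CASE SPLIT instead of a coverage claim.  Line C died
at its COVERAGE stub S1 `stub_exactCrossElement` ("every irreducible `Sh`-point has an exact cross-regular element"), FALSE in
nature on the `p = 3` Frobenius-twist fibres (negative lemma p96414, imported here BY NAME so that no stub of this file can be
an instance of it) — "NOT an engine failure: a coverage failure of the fixed crux" (strategist p1 census §1; dead file §1).
All three triagers and the dead-line lead asked for the same repair: make `ExactCross σ σ′ red ρ` a CASE HYPOTHESIS.  The crux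
being fixed, the repair is done INSIDE the composition: `by_cases ExactCross σ σ′ red ρ`.

* Case `ExactCross` (all big-image points of the generic sector; worker's recipe `γ₀ ↦ γ₀^{p^r}` inside an open image): line C
  VERBATIM with S1 := the case hypothesis — S2 `stub_crossRegularSupply` (LANDED p97490), S3 `stub_crossLevelRaisingSeed`
  (OPEN: ×-type level raising of the GIVEN automorphic `ρ₀` — the one place the crux's relative datum is consumed), S4
  `stub_crossTypePatching` (OPEN, the lever: integral `R^× = T^×` mod `p^N` at ×-type level, where BOTH obstructions of every
  patching argument at the split `𝔪` are neutralised — the ×-conditions at `#Q ≥ 2` level-RAISING primes `q ≢ 1 (p)` kill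
  the Taylor–Wiles-invisible cross dual Selmer (trace-orthogonality F1 only forbids `q ≡ 1` devices, census s1 F1⁺) AND cut
  the Yoshida locus to codimension ≥ 2), S5a `stub_mazurPrincipleModPN` (OPEN: level lowering mod `p^N`), S5b
  `stub_limitAtFixedLevel` (LANDED p99507), S5c = S5c′ `stub_finiteCuspidalSpectrum` (Harish-Chandra finiteness bridge,
  formalisation-grade) + landed p99281/p100841.  S3, S4, S5a are each STRICTLY SMALLER than the crux (dead file §3: S4 ≤
  target + LevelRaisingModPN, p102309) — the only registered line at this crux with that property.
* Case `¬ExactCross`: the NAMED RESIDUE `stub_anchoredLiftingNoExactCross` — the crux restricted to `Sh`-points WITHOUT an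
  exact cross-regular element (the corner `p = 3` / twist pairs, p146293, and the small-image points of the generic sector:
  induced `Ind_K τ`, `K` quadratic, with `τ̄` reducible).  `≤` crux (it IS the crux on a sub-locus), not `⟺` (it misses every
  big-image generic point); first support lemma wanted under it: the big-image dichotomy "generic fibre ∧ `ρ` irreducible `Sh`
  ∧ not induced ⇒ `ExactCross`" (Sen weights `(0,0,1,1)` exclude the principal `𝔰𝔩₂`; Lie-irreducible ⇒ `𝔰𝔭₄`).

Composition `ResiduallyYoshidaLifting_of : S3 → S4 → S5a → S5c′ → Residue → crux` BY NAME, kernel-checked (the chain of the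
dead skeleton rev 3, `stub_cruxUnfold` p95988, `mul_ne_zero`, `dvd_mul_of_dvd_left/right`).  Sorries: exactly the five
`stub_*`.  Disproof used: T6a + p96414 (S1 is NOT asserted; imported by name), T6b (S4 in the seeded binder order, verbatim
the dead rev 3), `not_withoutIrreducibleρ_of_witness` (`ρ` irreducible carried into S4/S5a), `iff_congruenceLifting`,
`trace_complexConjugation_eq_zero` (complex conjugation is a DEGENERATE cross element — hence EXACT REGULAR cross elements);
T17(d) does NOT apply: this line is genuinely relative (`Aut ρ₀` is consumed by S3).

References: Thorne2016 (Math. Ann. 364) §4.8, Thm 4.14, Cor 4.15, Prop 4.16, Lemma 5.18, Prop 5.20; KhareThorne2017;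
BoxerEtAl2021 §7; CalegariGeraghty2017; Sorensen2006 Thm A; WangHaining2022LevelRaising; van Hoften arXiv:1906.04008;
GeeTaibi2019; BorelJacquet1979 4.3 (i).
-/

noncomputable section

set_option linter.dupNamespace false

open scoped Matrix Classical
open Filter Set Function
open Summit.Langlands.Langlands.Cruxes.ResiduallyYoshidaLifting.CrossRegularAnnihilatorPrimes

-- `open scoped Classical` is REQUIRED (see the currency module p95988).

namespace Summit.Langlands.Langlands.Cruxes.ResiduallyYoshidaLifting.CrossPrimesAnchored

/-! ## Registered stubs of the line -/

/-- STUB S3 `stub_crossLevelRaisingSeed` (OPEN IN PRINT; verbatim the dead line C rev 3): ×-type LEVEL RAISING OF THE ANCHOR.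
From the automorphic irreducible `ρ₀` of shape `Sh` — the crux's relative datum, consumed here and only here — a base level
`𝔫₀ ≠ 0` and infinity type `T₀` such that at every finite set `Q` of residually cross-regular generic places (`QGoodRes`) there
is a cuspidal L-algebraic `π₁` of level `K(𝔫₀∏_Q v²)`, type `T₀`, with irreducible `Sh`-shaped `ρ₁` of ×-TYPE at each `v ∈ Q`
(`CrossType`; on GSp₄: Klingen-new of type IIIa).  Stable → stable level raising in weight (2,2): nearest print Sorensen2006
Thm A / WangHaining2022 (regular weight, definite inner form); the free parts (`Q = ∅`, `Aut ⇒ Member`, S3 ⇐ `CrossLevelRaising`)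
are LANDED (p99404).  Strictly smaller than the crux.
[cite: Sorensen2006, Thm. A] [cite: Thorne2016, §4.8 (the level-raising step of the Khare–Thorne method)] -/
theorem stub_crossLevelRaisingSeed :
    ∀ (p : ℕ) [Fact p.Prime], p ≠ 2 → ∀ (k : Type) [Field k] [CharP k p] [IsAlgClosed k] [TopologicalSpace k] [DiscreteTopology k] (red : Valued.integer (PadicAlgCl p) →+* k) (σ σ' : Literature.NumberTheory.GaloisRepresentations.FramedGaloisRep ℚ k 2) (hcpt : Literature.NumberTheory.Automorphic.isCompact_glFiniteIntegralLevel 4 ℚ) (ι : PadicAlgCl p ≃+* ℂ) (ρ₀ : Literature.NumberTheory.GaloisRepresentations.FramedGaloisRep ℚ (PadicAlgCl p) 4), σ.toGaloisRep.IsIrreducible → σ'.toGaloisRep.IsIrreducible → Summit.Langlands.Langlands.Cruxes.ResiduallyYoshidaLifting.CrossRegularAnnihilatorPrimes.DetCond p σ σ' → (¬ ∃ g : GL (Fin 2) k, ∀ x, g * σ x * g⁻¹ = σ' x) → ρ₀.toGaloisRep.IsIrreducible → Summit.Langlands.Langlands.Cruxes.ResiduallyYoshidaLifting.CrossRegularAnnihilatorPrimes.Sh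 σ σ' red ρ₀ → Summit.Langlands.Langlands.Cruxes.ResiduallyYoshidaLifting.CrossRegularAnnihilatorPrimes.Aut hcpt ι ρ₀ → ∃ (𝔫₀ : Ideal (NumberField.RingOfIntegers ℚ)) (T₀ : Literature.NumberTheory.Automorphic.InfinityType ℚ 4), 𝔫₀ ≠ 0 ∧ ∀ Q : Finset (IsDedekindDomain.HeightOneSpectrum (NumberField.RingOfIntegers ℚ)), (∀ v ∈ Q, Summit.Langlands.Langlands.Cruxes.ResiduallyYoshidaLifting.CrossRegularAnnihilatorPrimes.QGoodRes σ σ' 𝔫₀ ρ₀ v) → ∃ (π₁ : Literature.NumberTheory.Automorphic.CuspidalAutomorphicRepData 4 ℚ hcpt) (ρ₁ : Literature.NumberTheory.GaloisRepresentations.FramedGaloisRep ℚ (PadicAlgCl p) 4), Summit.Langlands.Langlands.Cruxes.ResiduallyYoshidaLifting.CrossRegularAnnihilatorPrimes.Member σ σ' red ι (𝔫₀ * Q.prod (fun v => v.asIdeal ^ 2)) T₀ π₁ ρ₁ ∧ ∀ v ∈ Q, Summit.Langlands.Langlands.Cruxes.ResiduallyYoshidaLifting.CrossRegularAnnihilatorPrimes.CrossType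 v ρ₁ := by
  sorry

/-- STUB S4 `stub_crossTypePatching` — THE LEVER, HARDEST (OPEN; verbatim the dead line C rev 3, seeded binder order = Disproof
T6b): integral `R^×_𝒮(N) = T^×_𝒮(N)` at ×-type level in weight (2,2), read as a Hecke-span congruence.  For `ρ` irreducible of
shape `Sh`, given the seed's `(𝔫₀, T₀)`, there are `(𝔫₁, T₁)` such that for every depth `N` and admissible `Q` (`QGood`,
`#Q ≥ 2`), a ×-type seed at `Q` yields a ×-type family of level `𝔫₁∏_Q v²` to which `ρ` is Hecke-span congruent mod `p^N`
(`CrossFamily`).  Why THIS `R = T` is better posed than any at the split `𝔪` of level `𝔫₁`: at the ×-primes `v ∈ Q`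
(`q_v ≢ 1 mod p`, level-RAISING, smooth Euler-neutral condition `𝒟_v^×` with a CROSS nilpotent tangent direction) the dual
condition `L_v^⊥` kills the Taylor–Wiles-invisible classes of `H¹(ℚ, Hom(σ̄′,σ̄)(1))` seen by `Frob_v` (Thorne2016 Lemma 5.18 /
Prop 5.20; trace-orthogonality forbids this only for `q ≡ 1` devices, census s1 F1⁺), and reducible ×-type deformations are
unramified at `v` with an exact eigenvalue relation, so with `#Q ≥ 2` the Yoshida locus has codimension ≥ 2 (CODIM.md's
codimension-0 obstruction is a feature of the MINIMAL level).  Remaining open core: Calegari–Geraghty patching of the weight-(2,2)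
higher-Hida 2-term complexes (`ℓ₀ = 1`) with a residually split `ρ̄` at ×-type level — not in print.  `≤` target +
LevelRaisingModPN (p102309): strictly smaller than the crux.
[cite: Thorne2016, Cor. 5.11, Prop. 5.20, §6] [cite: BoxerEtAl2021, §7] [cite: CalegariGeraghty2017, (ℓ₀ = 1)] -/
theorem stub_crossTypePatching :
    ∀ (p : ℕ) [Fact p.Prime], p ≠ 2 → ∀ (k : Type) [Field k] [CharP k p] [IsAlgClosed k] [TopologicalSpace k] [DiscreteTopology k] (red : Valued.integer (PadicAlgCl p) →+* k) (σ σ' : Literature.NumberTheory.GaloisRepresentations.FramedGaloisRep ℚ k 2) (hcpt : Literature.NumberTheory.Automorphic.isCompact_glFiniteIntegralLevel 4 ℚ) (ι : PadicAlgCl p ≃+* ℂ) (ρ : Literature.NumberTheory.GaloisRepresentations.FramedGaloisRep ℚ (PadicAlgCl p) 4), σ.toGaloisRep.IsIrreducible → σ'.toGaloisRep.IsIrreducible → Summit.Langlands.Langlands.Cruxes.ResiduallyYoshidaLifting.CrossRegularAnnihilatorPrimes.DetCond p σ σ' → (¬ ∃ g : GL (Fin 2) k, ∀ x, g * σ x *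 g⁻¹ = σ' x) → ρ.toGaloisRep.IsIrreducible → Summit.Langlands.Langlands.Cruxes.ResiduallyYoshidaLifting.CrossRegularAnnihilatorPrimes.Sh σ σ' red ρ → ∀ (𝔫₀ : Ideal (NumberField.RingOfIntegers ℚ)) (T₀ : Literature.NumberTheory.Automorphic.InfinityType ℚ 4), 𝔫₀ ≠ 0 → ∃ (𝔫₁ : Ideal (NumberField.RingOfIntegers ℚ)) (T₁ : Literature.NumberTheory.Automorphic.InfinityType ℚ 4), 𝔫₁ ≠ 0 ∧ ∀ (N : ℕ) (Q : Finset (IsDedekindDomain.HeightOneSpectrum (NumberField.RingOfIntegers ℚ))), (∀ v ∈ Q, Summit.Langlands.Langlands.Cruxes.ResiduallyYoshidaLifting.CrossRegularAnnihilatorPrimes.QGood σ σ' red 𝔫₁ ρ N v) → 2 ≤ Q.card → (∃ (π₁ : Literature.NumberTheory.Automorphic.CuspidalAutomorphicRepData 4 ℚ hcpt) (ρ₁ : Literature.NumberTheory.GaloisRepresentations.FramedGaloisRep ℚ (PadicAlgCl p) 4), (∀ v ∈ Q, ¬ (v.asIdeal ∣ 𝔫₀)) ∧ Summit.Langlands.Langlands.Cruxes.ResiduallyYoshidaLifting.CrossRegularAnnihilatorPrimes.Member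 σ σ' red ι (𝔫₀ * Q.prod (fun v => v.asIdeal ^ 2)) T₀ π₁ ρ₁ ∧ ∀ v ∈ Q, Summit.Langlands.Langlands.Cruxes.ResiduallyYoshidaLifting.CrossRegularAnnihilatorPrimes.CrossType v ρ₁) → Summit.Langlands.Langlands.Cruxes.ResiduallyYoshidaLifting.CrossRegularAnnihilatorPrimes.CrossFamily σ σ' red hcpt ι 𝔫₁ T₁ Q N ρ := by
  sorry

/-- STUB S5a `stub_mazurPrincipleModPN` (OPEN IN PRINT; verbatim the dead line C rev 3): Mazur's principle / level lowering mod
`p^N` at the auxiliary ×-primes, at a residually-Yoshida `𝔪` in weight (2,2): a ×-type family congruence at level `K(𝔫₁∏_Q v²)`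
descends to finitely many members of level `K(𝔫₁)` (`ρ` is unramified at `Q`).  Nearest print: Thorne2016 Thm 4.14 / Prop 4.16
(GL₂, non-Eisenstein), van Hoften 1906.04008 Thm 1.2 (GSp₄, `ρ̄` irreducible, regular weight).  Strictly smaller than the crux.
[cite: Thorne2016, Thm. 4.14 and Prop. 4.16] -/
theorem stub_mazurPrincipleModPN :
    ∀ (p : ℕ) [Fact p.Prime], p ≠ 2 → ∀ (k : Type) [Field k] [CharP k p] [IsAlgClosed k] [TopologicalSpace k] [DiscreteTopology k] (red : Valued.integer (PadicAlgCl p) →+* k) (σ σ' : Literature.NumberTheory.GaloisRepresentations.FramedGaloisRep ℚ k 2) (hcpt : Literature.NumberTheory.Automorphic.isCompact_glFiniteIntegralLevel 4 ℚ) (ι : PadicAlgCl p ≃+* ℂ) (ρ : Literature.NumberTheory.GaloisRepresentations.FramedGaloisRep ℚ (PadicAlgCl p) 4), σ.toGaloisRep.IsIrreducible → σ'.toGaloisRep.IsIrreducible → Summit.Langlands.Langlands.Cruxes.ResiduallyYoshidaLifting.CrossRegularAnnihilatorPrimes.DetCond p σ σ' → (¬ ∃ g : GL (Fin 2) k, ∀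 x, g * σ x * g⁻¹ = σ' x) → ρ.toGaloisRep.IsIrreducible → Summit.Langlands.Langlands.Cruxes.ResiduallyYoshidaLifting.CrossRegularAnnihilatorPrimes.Sh σ σ' red ρ → ∀ (𝔫₁ : Ideal (NumberField.RingOfIntegers ℚ)) (T₁ : Literature.NumberTheory.Automorphic.InfinityType ℚ 4), 𝔫₁ ≠ 0 → ∀ (N : ℕ) (Q : Finset (IsDedekindDomain.HeightOneSpectrum (NumberField.RingOfIntegers ℚ))), (∀ v ∈ Q, Summit.Langlands.Langlands.Cruxes.ResiduallyYoshidaLifting.CrossRegularAnnihilatorPrimes.QGood σ σ' red 𝔫₁ ρ N v) → Summit.Langlands.Langlands.Cruxes.ResiduallyYoshidaLifting.CrossRegularAnnihilatorPrimes.CrossFamily σ σ' red hcpt ι 𝔫₁ T₁ Q N ρ → ∃ (r : ℕ) (πf : Fin r → Literature.NumberTheory.Automorphic.CuspidalAutomorphicRepData 4 ℚ hcpt) (ρf : Fin r → Literature.NumberTheory.GaloisRepresentations.FramedGaloisRep ℚ (PadicAlgCl p) 4), (∀ i, Summit.Langlands.Langlands.Cruxes.ResiduallyYoshidaLifting.CrossRegularAnnihilatorPrimes.Member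 σ σ' red ι 𝔫₁ T₁ (πf i) (ρf i)) ∧ Summit.Langlands.Langlands.Cruxes.ResiduallyYoshidaLifting.CrossRegularAnnihilatorPrimes.HSC N r ρf ρ := by
  sorry

/-- STUB S5c′ `stub_finiteCuspidalSpectrum` (the AUTOMORPHIC FINITENESS BRIDGE `H_fin`; verbatim the dead line C rev 3):
cuspidal automorphic representations of `GL₄(𝔸_ℚ)` with a `K(𝔫₁)`-fixed vector in `W ∖ W′` and infinity type `T₁` fall into
finitely many near-equivalence classes.  Harish-Chandra finiteness in representation form (Borel–Jacquet 1979, 4.3 (i)); the tree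
PROVES the forms version `harishChandra_finiteness_gl_holds`; missing: `K_∞`-type control by the infinity type (a Literature fact
to file) + finiteness of Hecke eigensystems on a finite-dimensional space.  FORMALISATION-GRADE, landable.
[cite: BorelJacquet1979, 4.3 (i)] -/
theorem stub_finiteCuspidalSpectrum :
    ∀ (p : ℕ) [Fact p.Prime], p ≠ 2 → ∀ (k : Type) [Field k] [CharP k p] [IsAlgClosed k] [TopologicalSpace k] [DiscreteTopology k] (red : Valued.integer (PadicAlgCl p) →+* k) (σ σ' : Literature.NumberTheory.GaloisRepresentations.FramedGaloisRep ℚ k 2) (hcpt : Literature.NumberTheory.Automorphic.isCompact_glFiniteIntegralLevel 4 ℚ) (ι : PadicAlgCl p ≃+* ℂ) (𝔫₁ : Ideal (NumberField.RingOfIntegers ℚ)) (T₁ : Literature.NumberTheory.Automorphic.InfinityType ℚ 4), 𝔫₁ ≠ 0 → ∃ (s : ℕ) (πc : Fin s → Literature.NumberTheory.Automorphic.CuspidalAutomorphicRepData 4 ℚ hcpt), ∀ π : Literature.NumberTheory.Automorphic.CuspidalAutomorphicRepData 4 ℚ hcpt, π.1.HasInfinityType T₁ → (∃ φ ∈ π.1.W,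 φ ∉ π.1.W' ∧ ∀ u ∈ Literature.NumberTheory.Automorphic.principalCongruenceLevel 4 ℚ 𝔫₁, Literature.NumberTheory.Automorphic.rightTranslation (Literature.NumberTheory.Automorphic.AdelicGroupData.gl 4 ℚ) u φ = φ) → ∃ j, π.1.IsNearlyEquivalent (πc j).1 := by
  sorry

/-- STUB R `stub_anchoredLiftingNoExactCross` — THE NAMED RESIDUE (replaces line C's false coverage stub S1): the crux
RESTRICTED to `Sh`-points `ρ` with NO exact cross-regular element in their image (`¬ ExactCross σ σ′ red ρ`), the anchor `ρ₀`
kept.  Where it lives: the corner (`p = 3`: no residual cross-regular class at all on Frobenius-twist fibres, p96414 /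
Disproof T6a; twist pairs `σ̄′ ≅ σ̄⊗ω_K`), and the small-image points of the generic sector (`ρ ≅ Ind_K^ℚ τ`, `K` quadratic,
`τ̄` reducible over `K`; `ρ = Ind` of a Hecke character of a quartic CM field) — for big-image generic points `ExactCross`
holds (open image + one residual generic cross class, worker recipe `γ₀ ↦ γ₀^{p^r}`), so this stub is NOT the crux: the probe
`stub → crux` fails (it misses every big-image generic point), `crux → stub` holds (restriction).  Engines with reach on
sub-loci: `Ind_K τ`, `K` real ⇒ residually reducible ordinary Hilbert lifting over `K` (Skinner–Wiles / Thorne 2015 type);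
`K` imaginary ⇒ weight-2 Bianchi (open for small image); `p = 3` phantom-RM fibres: none.  First support lemma wanted: the
big-image dichotomy making the residue EXPLICIT (Sen weights `(0,0,1,1)` exclude the principal `𝔰𝔩₂`; Lie-irreducible ⇒ `𝔰𝔭₄`;
Lie-reducible irreducible ⇒ induced from a quadratic or quartic field).
[cite: Thorne2016, Prop. 5.20 (the role of the exact element)] [cite: SkinnerWiles1999, Thm. (residually reducible ordinary lifting over totally real K)] -/
theorem stub_anchoredLiftingNoExactCross :
    ∀ (p : ℕ) [Fact p.Prime], p ≠ 2 → ∀ (k : Type) [Field k] [CharP k p] [IsAlgClosed k] [TopologicalSpace k] [DiscreteTopology k] (red : Valued.integer (PadicAlgCl p) →+* k) (σ σ' : Literature.NumberTheory.GaloisRepresentations.FramedGaloisRep ℚ k 2) (hcpt : Literature.NumberTheory.Automorphic.isCompact_glFiniteIntegralLevel 4 ℚ) (ι : PadicAlgCl p ≃+* ℂ) (ρ₀ ρ : Literature.NumberTheory.GaloisRepresentations.FramedGaloisRep ℚ (PadicAlgCl p) 4), σ.toGaloisRep.IsIrreducible → σ'.toGaloisRep.IsIrreducible → Summit.Langlands.Langlands.Cruxes.ResiduallyYoshidaLifting.CrossRegularAnnihilatorPrimes.DetCond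 p σ σ' → (¬ ∃ g : GL (Fin 2) k, ∀ x, g * σ x * g⁻¹ = σ' x) → ρ₀.toGaloisRep.IsIrreducible → Summit.Langlands.Langlands.Cruxes.ResiduallyYoshidaLifting.CrossRegularAnnihilatorPrimes.Sh σ σ' red ρ₀ → Summit.Langlands.Langlands.Cruxes.ResiduallyYoshidaLifting.CrossRegularAnnihilatorPrimes.Aut hcpt ι ρ₀ → ρ.toGaloisRep.IsIrreducible → Summit.Langlands.Langlands.Cruxes.ResiduallyYoshidaLifting.CrossRegularAnnihilatorPrimes.Sh σ σ' red ρ → ¬ Summit.Langlands.Langlands.Cruxes.ResiduallyYoshidaLifting.CrossRegularAnnihilatorPrimes.ExactCross σ σ' red ρ → Summit.Langlands.Langlands.Cruxes.ResiduallyYoshidaLifting.CrossRegularAnnihilatorPrimes.Aut hcpt ι ρ := by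
  sorry

-- STUB S2 `stub_crossRegularSupply` LANDED (p97490) and imported; STUB S5b `stub_limitAtFixedLevel` LANDED (p99507) and imported;
-- S5c-glue LANDED (p99281, p100841); S3 free parts LANDED (p99404); S0 `stub_cruxUnfold` LANDED (p95988).

/-! ## Derived statements (theorems from the stubs; verbatim the dead skeleton rev 3) -/



/-! ## Name-keyed aliases of the registered stub statements -/
namespace Registered

/-- Alias of the S3 statement keyed by the registered stub name. -/
abbrev stub_crossLevelRaisingSeed : Prop :=
  ∀ (p : ℕ) [Fact p.Prime], p ≠ 2 → ∀ (k : Type) [Field k] [CharP k p] [IsAlgClosed k] [TopologicalSpace k] [DiscreteTopology k] (red : Valued.integer (PadicAlgCl p) →+* k) (σ σ' : Literature.NumberTheory.GaloisRepresentations.FramedGaloisRep ℚ k 2) (hcpt : Literature.NumberTheory.Automorphic.isCompact_glFiniteIntegralLevel 4 ℚ) (ι : PadicAlgCl p ≃+* ℂ) (ρ₀ : Literature.NumberTheory.GaloisRepresentations.FramedGaloisRep ℚ (PadicAlgCl p) 4), σ.toGaloisRep.IsIrreducible → σ'.toGaloisRep.IsIrreducible → Summit.Langlands.Langlands.Cruxes.ResiduallyYoshidaLifting.CrossRegularAnnihilatorPrimes.DetCond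 p σ σ' → (¬ ∃ g : GL (Fin 2) k, ∀ x, g * σ x * g⁻¹ = σ' x) → ρ₀.toGaloisRep.IsIrreducible → Summit.Langlands.Langlands.Cruxes.ResiduallyYoshidaLifting.CrossRegularAnnihilatorPrimes.Sh σ σ' red ρ₀ → Summit.Langlands.Langlands.Cruxes.ResiduallyYoshidaLifting.CrossRegularAnnihilatorPrimes.Aut hcpt ι ρ₀ → ∃ (𝔫₀ : Ideal (NumberField.RingOfIntegers ℚ)) (T₀ : Literature.NumberTheory.Automorphic.InfinityType ℚ 4), 𝔫₀ ≠ 0 ∧ ∀ Q : Finset (IsDedekindDomain.HeightOneSpectrum (NumberField.RingOfIntegers ℚ)), (∀ v ∈ Q, Summit.Langlands.Langlands.Cruxes.ResiduallyYoshidaLifting.CrossRegularAnnihilatorPrimes.QGoodRes σ σ' 𝔫₀ ρ₀ v) → ∃ (π₁ : Literature.NumberTheory.Automorphic.CuspidalAutomorphicRepData 4 ℚ hcpt) (ρ₁ : Literature.NumberTheory.GaloisRepresentations.FramedGaloisRep ℚ (PadicAlgCl p) 4), Summit.Langlands.Langlands.Cruxes.ResiduallyYoshidaLifting.CrossRegularAnnihilatorPrimes.Member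 σ σ' red ι (𝔫₀ * Q.prod (fun v => v.asIdeal ^ 2)) T₀ π₁ ρ₁ ∧ ∀ v ∈ Q, Summit.Langlands.Langlands.Cruxes.ResiduallyYoshidaLifting.CrossRegularAnnihilatorPrimes.CrossType v ρ₁
/-- Alias of the S4 statement keyed by the registered stub name. -/
abbrev stub_crossTypePatching : Prop :=
  ∀ (p : ℕ) [Fact p.Prime], p ≠ 2 → ∀ (k : Type) [Field k] [CharP k p] [IsAlgClosed k] [TopologicalSpace k] [DiscreteTopology k] (red : Valued.integer (PadicAlgCl p) →+* k) (σ σ' : Literature.NumberTheory.GaloisRepresentations.FramedGaloisRep ℚ k 2) (hcpt : Literature.NumberTheory.Automorphic.isCompact_glFiniteIntegralLevel 4 ℚ) (ι : PadicAlgCl p ≃+* ℂ) (ρ : Literature.NumberTheory.GaloisRepresentations.FramedGaloisRep ℚ (PadicAlgCl p) 4), σ.toGaloisRep.IsIrreducible → σ'.toGaloisRep.IsIrreducible → Summit.Langlands.Langlands.Cruxes.ResiduallyYoshidaLifting.CrossRegularAnnihilatorPrimes.DetCond p σ σ' → (¬ ∃ g : GL (Fin 2) k, ∀ x, g * σ x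 * g⁻¹ = σ' x) → ρ.toGaloisRep.IsIrreducible → Summit.Langlands.Langlands.Cruxes.ResiduallyYoshidaLifting.CrossRegularAnnihilatorPrimes.Sh σ σ' red ρ → ∀ (𝔫₀ : Ideal (NumberField.RingOfIntegers ℚ)) (T₀ : Literature.NumberTheory.Automorphic.InfinityType ℚ 4), 𝔫₀ ≠ 0 → ∃ (𝔫₁ : Ideal (NumberField.RingOfIntegers ℚ)) (T₁ : Literature.NumberTheory.Automorphic.InfinityType ℚ 4), 𝔫₁ ≠ 0 ∧ ∀ (N : ℕ) (Q : Finset (IsDedekindDomain.HeightOneSpectrum (NumberField.RingOfIntegers ℚ))), (∀ v ∈ Q, Summit.Langlands.Langlands.Cruxes.ResiduallyYoshidaLifting.CrossRegularAnnihilatorPrimes.QGood σ σ' red 𝔫₁ ρ N v) → 2 ≤ Q.card → (∃ (π₁ : Literature.NumberTheory.Automorphic.CuspidalAutomorphicRepData 4 ℚ hcpt) (ρ₁ : Literature.NumberTheory.GaloisRepresentations.FramedGaloisRep ℚ (PadicAlgCl p) 4), (∀ v ∈ Q, ¬ (v.asIdeal ∣ 𝔫₀)) ∧ Summit.Langlands.Langlands.Cruxes.ResiduallyYoshidaLifting.CrossRegularAnnihilatorPrimes.Member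 σ σ' red ι (𝔫₀ * Q.prod (fun v => v.asIdeal ^ 2)) T₀ π₁ ρ₁ ∧ ∀ v ∈ Q, Summit.Langlands.Langlands.Cruxes.ResiduallyYoshidaLifting.CrossRegularAnnihilatorPrimes.CrossType v ρ₁) → Summit.Langlands.Langlands.Cruxes.ResiduallyYoshidaLifting.CrossRegularAnnihilatorPrimes.CrossFamily σ σ' red hcpt ι 𝔫₁ T₁ Q N ρ
/-- Alias of the S5a statement keyed by the registered stub name. -/
abbrev stub_mazurPrincipleModPN : Prop :=
  ∀ (p : ℕ) [Fact p.Prime], p ≠ 2 → ∀ (k : Type) [Field k] [CharP k p] [IsAlgClosed k] [TopologicalSpace k] [DiscreteTopology k] (red : Valued.integer (PadicAlgCl p) →+* k) (σ σ' : Literature.NumberTheory.GaloisRepresentations.FramedGaloisRep ℚ k 2) (hcpt : Literature.NumberTheory.Automorphic.isCompact_glFiniteIntegralLevel 4 ℚ) (ι : PadicAlgCl p ≃+* ℂ) (ρ : Literature.NumberTheory.GaloisRepresentations.FramedGaloisRep ℚ (PadicAlgCl p) 4), σ.toGaloisRep.IsIrreducible → σ'.toGaloisRep.IsIrreducible → Summit.Langlands.Langlands.Cruxes.ResiduallyYoshidaLifting.CrossRegularAnnihilatorPrimes.DetCond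 p σ σ' → (¬ ∃ g : GL (Fin 2) k, ∀ x, g * σ x * g⁻¹ = σ' x) → ρ.toGaloisRep.IsIrreducible → Summit.Langlands.Langlands.Cruxes.ResiduallyYoshidaLifting.CrossRegularAnnihilatorPrimes.Sh σ σ' red ρ → ∀ (𝔫₁ : Ideal (NumberField.RingOfIntegers ℚ)) (T₁ : Literature.NumberTheory.Automorphic.InfinityType ℚ 4), 𝔫₁ ≠ 0 → ∀ (N : ℕ) (Q : Finset (IsDedekindDomain.HeightOneSpectrum (NumberField.RingOfIntegers ℚ))), (∀ v ∈ Q, Summit.Langlands.Langlands.Cruxes.ResiduallyYoshidaLifting.CrossRegularAnnihilatorPrimes.QGood σ σ' red 𝔫₁ ρ N v) → Summit.Langlands.Langlands.Cruxes.ResiduallyYoshidaLifting.CrossRegularAnnihilatorPrimes.CrossFamily σ σ' red hcpt ι 𝔫₁ T₁ Q N ρ → ∃ (r : ℕ) (πf : Fin r → Literature.NumberTheory.Automorphic.CuspidalAutomorphicRepData 4 ℚ hcpt) (ρf : Fin r → Literature.NumberTheory.GaloisRepresentations.FramedGaloisRep ℚ (PadicAlgCl p) 4), (∀ i, Summit.Langlands.Langlands.Cruxes.ResiduallyYoshidaLifting.CrossRegularAnnihilatorPrimes.Member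 σ σ' red ι 𝔫₁ T₁ (πf i) (ρf i)) ∧ Summit.Langlands.Langlands.Cruxes.ResiduallyYoshidaLifting.CrossRegularAnnihilatorPrimes.HSC N r ρf ρ
/-- Alias of the S5c′ statement keyed by the registered stub name. -/
abbrev stub_finiteCuspidalSpectrum : Prop :=
  ∀ (p : ℕ) [Fact p.Prime], p ≠ 2 → ∀ (k : Type) [Field k] [CharP k p] [IsAlgClosed k] [TopologicalSpace k] [DiscreteTopology k] (red : Valued.integer (PadicAlgCl p) →+* k) (σ σ' : Literature.NumberTheory.GaloisRepresentations.FramedGaloisRep ℚ k 2) (hcpt : Literature.NumberTheory.Automorphic.isCompact_glFiniteIntegralLevel 4 ℚ) (ι : PadicAlgCl p ≃+* ℂ) (𝔫₁ : Ideal (NumberField.RingOfIntegers ℚ)) (T₁ : Literature.NumberTheory.Automorphic.InfinityType ℚ 4), 𝔫₁ ≠ 0 → ∃ (s : ℕ) (πc : Fin s → Literature.NumberTheory.Automorphic.CuspidalAutomorphicRepData 4 ℚ hcpt), ∀ π : Literature.NumberTheory.Automorphic.CuspidalAutomorphicRepData 4 ℚ hcpt, π.1.HasInfinityType T₁ → (∃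 φ ∈ π.1.W, φ ∉ π.1.W' ∧ ∀ u ∈ Literature.NumberTheory.Automorphic.principalCongruenceLevel 4 ℚ 𝔫₁, Literature.NumberTheory.Automorphic.rightTranslation (Literature.NumberTheory.Automorphic.AdelicGroupData.gl 4 ℚ) u φ = φ) → ∃ j, π.1.IsNearlyEquivalent (πc j).1
/-- Alias of the residue statement keyed by the registered stub name. -/
abbrev stub_anchoredLiftingNoExactCross : Prop :=
  ∀ (p : ℕ) [Fact p.Prime], p ≠ 2 → ∀ (k : Type) [Field k] [CharP k p] [IsAlgClosed k] [TopologicalSpace k] [DiscreteTopology k] (red : Valued.integer (PadicAlgCl p) →+* k) (σ σ' : Literature.NumberTheory.GaloisRepresentations.FramedGaloisRep ℚ k 2) (hcpt : Literature.NumberTheory.Automorphic.isCompact_glFiniteIntegralLevel 4 ℚ) (ι : PadicAlgCl p ≃+* ℂ) (ρ₀ ρ : Literature.NumberTheory.GaloisRepresentations.FramedGaloisRep ℚ (PadicAlgCl p) 4), σ.toGaloisRep.IsIrreducible → σ'.toGaloisRep.IsIrreducible → Summit.Langlands.Langlands.Cruxes.ResiduallyYoshidaLifting.CrossRegularAnnihilatorPrimes.DetCond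 p σ σ' → (¬ ∃ g : GL (Fin 2) k, ∀ x, g * σ x * g⁻¹ = σ' x) → ρ₀.toGaloisRep.IsIrreducible → Summit.Langlands.Langlands.Cruxes.ResiduallyYoshidaLifting.CrossRegularAnnihilatorPrimes.Sh σ σ' red ρ₀ → Summit.Langlands.Langlands.Cruxes.ResiduallyYoshidaLifting.CrossRegularAnnihilatorPrimes.Aut hcpt ι ρ₀ → ρ.toGaloisRep.IsIrreducible → Summit.Langlands.Langlands.Cruxes.ResiduallyYoshidaLifting.CrossRegularAnnihilatorPrimes.Sh σ σ' red ρ → ¬ Summit.Langlands.Langlands.Cruxes.ResiduallyYoshidaLifting.CrossRegularAnnihilatorPrimes.ExactCross σ σ' red ρ → Summit.Langlands.Langlands.Cruxes.ResiduallyYoshidaLifting.CrossRegularAnnihilatorPrimes.Aut hcpt ι ρ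

end Registered

/-! ## Composition (kernel-checked, no sorry outside `stub_*`): the five stubs conclude the crux BY NAME

Pure logic: unfold the crux over the currency (`stub_cruxUnfold`, p95988); `by_cases` on `ExactCross σ σ′ red ρ`.  With an
exact element: S3 (applied to `ρ₀`) gives the seed's `(𝔫₀, T₀)` and ×-type seeds at every residually admissible `Q`; S4 (applied
to `ρ`, seeded) gives `(𝔫₁, T₁)`; for each depth `N` the landed S2 (avoiding `𝔫₀𝔫₁`, `#Q ≥ 2`) supplies `Q_N`, S3 the seed at
`Q_N`, S4 the ×-family with `HSC N`; S5a lowers to level `𝔫₁`, S5c′ (through the landed p100841 + p99281) gives the finite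
trace catalogue, the landed S5b takes the limit: `Aut ρ`.  Without an exact element: the residue stub. -/

/-- Successive approximation at a fixed level from S5a + S5c′ (+ landed S5b, S5c-glue): hypotheses form. -/
theorem successiveApproximation_of
    (h5a : Registered.stub_mazurPrincipleModPN) (h5c : Registered.stub_finiteCuspidalSpectrum) :
    ∀ (p : ℕ) [Fact p.Prime], p ≠ 2 → ∀ (k : Type) [Field k] [CharP k p] [IsAlgClosed k] [TopologicalSpace k] [DiscreteTopology k] (red : Valued.integer (PadicAlgCl p) →+* k) (σ σ' : Literature.NumberTheory.GaloisRepresentations.FramedGaloisRep ℚ k 2) (hcpt : Literature.NumberTheory.Automorphic.isCompact_glFiniteIntegralLevel 4 ℚ) (ι : PadicAlgCl p ≃+* ℂ) (ρ : Literature.NumberTheory.GaloisRepresentations.FramedGaloisRep ℚ (PadicAlgCl p) 4), σ.toGaloisRep.IsIrreducible → σ'.toGaloisRep.IsIrreducible → Summit.Langlands.Langlands.Cruxes.ResiduallyYoshidaLifting.CrossRegularAnnihilatorPrimes.DetCond p σ σ' → (¬ ∃ g : GL (Fin 2) k, ∀ x, g * σ x * g⁻¹ = σ' x) → ρ.toGaloisRep.IsIrreducible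 → Summit.Langlands.Langlands.Cruxes.ResiduallyYoshidaLifting.CrossRegularAnnihilatorPrimes.Sh σ σ' red ρ → ∀ (𝔫₁ : Ideal (NumberField.RingOfIntegers ℚ)) (T₁ : Literature.NumberTheory.Automorphic.InfinityType ℚ 4), 𝔫₁ ≠ 0 → (∀ N : ℕ, ∃ Q : Finset (IsDedekindDomain.HeightOneSpectrum (NumberField.RingOfIntegers ℚ)), (∀ v ∈ Q, Summit.Langlands.Langlands.Cruxes.ResiduallyYoshidaLifting.CrossRegularAnnihilatorPrimes.QGood σ σ' red 𝔫₁ ρ N v) ∧ Summit.Langlands.Langlands.Cruxes.ResiduallyYoshidaLifting.CrossRegularAnnihilatorPrimes.CrossFamily σ σ' red hcpt ι 𝔫₁ T₁ Q N ρ) → Summit.Langlands.Langlands.Cruxes.ResiduallyYoshidaLifting.CrossRegularAnnihilatorPrimes.Aut hcpt ι ρ := by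
  intro p _ hp k _ _ _ _ _ red σ σ' hcpt ι ρ hirr hirr' hdet hnc hirrρ hShρ 𝔫₁ T₁ h𝔫₁ hfam
  have hcat := stub_traceCatalogue_of_frobCatalogue p hp k red σ σ' hcpt ι 𝔫₁ T₁ h𝔫₁
    (frobCatalogue_of_finiteCuspidal p hp k red σ σ' hcpt ι 𝔫₁ T₁ h𝔫₁ (h5c p hp k red σ σ' hcpt ι 𝔫₁ T₁ h𝔫₁))
  refine stub_limitAtFixedLevel p hp k red σ σ' hcpt ι ρ hShρ 𝔫₁ T₁ hcat fun N => ?_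
  obtain ⟨Q, hQ, hCF⟩ := hfam N
  exact h5a p hp k red σ σ' hcpt ι ρ hirr hirr' hdet hnc hirrρ hShρ 𝔫₁ T₁ h𝔫₁ N Q hQ hCF

/-- **`ResiduallyYoshidaLifting_of`** — S3 → S4 → S5a → S5c′ → Residue → the crux `ResiduallyYoshidaLifting`, BY NAME.
[cite: Thorne2016, Cor. 4.15 (architecture of the argument)] -/
theorem ResiduallyYoshidaLifting_of (h3 : Registered.stub_crossLevelRaisingSeed) (h4 : Registered.stub_crossTypePatching)
    (h5a : Registered.stub_mazurPrincipleModPN) (h5c : Registered.stub_finiteCuspidalSpectrum)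
    (hR : Registered.stub_anchoredLiftingNoExactCross) :
    Summit.Langlands.Langlands.Theses.PhantomRMYoshida.ResiduallyYoshidaLifting := by
  refine stub_cruxUnfold.mpr ?_
  intro p _ hp k _ _ _ _ _ red σ σ' hcpt ι ρ₀ ρ hodd hodd' hirr hirr' hdet hnc hirr₀ hSh₀ hAut₀ hirrρ hShρ
  by_cases hX : Summit.Langlands.Langlands.Cruxes.ResiduallyYoshidaLifting.CrossRegularAnnihilatorPrimes.ExactCross σ σ' red ρ
  · -- S3: base level / infinity type of the seed and ×-type level raising of `ρ₀`
    obtain ⟨𝔫₀, T₀, h𝔫₀, hseed⟩ := h3 p hp k red σ σ' hcpt ι ρ₀ hirr hirr' hdet hnc hirr₀ hSh₀ hAut₀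
    -- S4 (seeded): level / infinity type of the ×-families GIVEN the seed level, and the patching statement for `ρ`
    obtain ⟨𝔫₁, T₁, h𝔫₁, hpatch⟩ := h4 p hp k red σ σ' hcpt ι ρ hirr hirr' hdet hnc hirrρ hShρ 𝔫₀ T₀ h𝔫₀
    -- S5: successive approximation at level `𝔫₁`
    refine successiveApproximation_of h5a h5c p hp k red σ σ' hcpt ι ρ hirr hirr' hdet hnc hirrρ hShρ 𝔫₁ T₁ h𝔫₁ ?_
    intro N
    -- S2 (landed): auxiliary primes of depth `N`, prime to `𝔫₀ 𝔫₁`, at least two of them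
    obtain ⟨Q, hcard, hQ⟩ := stub_crossRegularSupply p hp k red σ σ' hcpt ι ρ₀ ρ hSh₀ hShρ hX (𝔫₀ * 𝔫₁)
      (mul_ne_zero h𝔫₀ h𝔫₁) 2 N
    refine ⟨Q, fun v hv => ?_, ?_⟩
    · obtain ⟨hρ₀v, hdvd, hvp, hρv, hσv, hσ'v, a, b, hcongr, hres⟩ := hQ v hv
      exact ⟨fun h1 => hdvd (dvd_mul_of_dvd_right h1 𝔫₀), hvp, hρv, hσv, hσ'v, a, b, hcongr, hres⟩
    · obtain ⟨π₁, ρ₁, hmem, hx₁⟩ := hseed Q (fun v hv => by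
        obtain ⟨hρ₀v, hdvd, hvp, hρv, hσv, hσ'v, a, b, hcongr, hres⟩ := hQ v hv
        exact ⟨fun h0 => hdvd (dvd_mul_of_dvd_left h0 𝔫₁), hvp, hρ₀v, hσv, hσ'v, red a, red b, hres⟩)
      exact hpatch N Q (fun v hv => by
        obtain ⟨hρ₀v, hdvd, hvp, hρv, hσv, hσ'v, a, b, hcongr, hres⟩ := hQ v hv
        exact ⟨fun h1 => hdvd (dvd_mul_of_dvd_right h1 𝔫₀), hvp, hρv, hσv, hσ'v, a, b, hcongr, hres⟩) hcard
        ⟨π₁, ρ₁, fun v hv => fun h0 => (hQ v hv).2.1 (dvd_mul_of_dvd_left h0 𝔫₁), hmem, hx₁⟩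
  · -- the named residue
    exact hR p hp k red σ σ' hcpt ι ρ₀ ρ hirr hirr' hdet hnc hirr₀ hSh₀ hAut₀ hirrρ hShρ hX

/-- Wiring check: the registered stubs feed `ResiduallyYoshidaLifting_of` as stated. -/
example : Summit.Langlands.Langlands.Theses.PhantomRMYoshida.ResiduallyYoshidaLifting :=
  ResiduallyYoshidaLifting_of stub_crossLevelRaisingSeed stub_crossTypePatching stub_mazurPrincipleModPN
    stub_finiteCuspidalSpectrum stub_anchoredLiftingNoExactCross

/-- Negative-lemma import check: line C's false coverage stub is a NAMED theorem of the tree (p96414); none of the five stubs of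
this line asserts `ExactCross`, and the residue stub is stated on its complement. -/
example := @Summit.Langlands.Langlands.Cruxes.ResiduallyYoshidaLifting.CrossRegularAnnihilatorPrimes.stub_exactCrossElement_false_of_frobTwistThree

end Summit.Langlands.Langlands.Cruxes.ResiduallyYoshidaLifting.CrossPrimesAnchored

end
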